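import Literature.Topology.FourManifolds.SimplifiedBrokenLefschetzSidesGenus
import Literature.Topology.FourManifolds.DehnSurgeryUnknotZeroProofs
import Literature.Topology.FourManifolds.Morse
import Literature.Topology.FourManifolds.SphereFourGenusOneSplitting
import Literature.Topology.FourManifolds.TorusDiffeoLoops
import Literature.Topology.FourManifolds.SmoothSchoenfliesFiveLeCap
import Literature.Topology.FourManifolds.SimplifiedBrokenLefschetzSphereSideTube
import HarnessLib
set_option linter.dupNamespace false
noncomputable section
open scoped Manifold ContDiff Topology RealInnerProductSpace
open Set Function Literature.Topology.FourManifolds Literature.AlgebraicTopology.SingularHomology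
namespace Summit.SmoothPoincare4.SmoothPoincare4.Cruxes.RungOne.Sketch
/-- notation -/
local notation "𝔼 " n:arg => EuclideanSpace ℝ (Fin n)
/-- notation -/
local notation "𝕊²" => (Metric.sphere (0 : EuclideanSpace ℝ (Fin 3)) (1 : ℝ))
attribute [local instance] Literature.Topology.FourManifolds.fact_finrank_euclideanSpace_succ
/-- Statement N (registered `helper_sliceGluing_foldNormalForm`). -/
def StatementN : Prop :=
  ∀ (X : Type) [TopologicalSpace X] [T2Space X] [SecondCountableTopology X] [CompactSpace X] [ChartedSpace (𝔼 4) X] [IsManifold (𝓡 4) ∞ X] (o : SmoothOrientation (𝓡 4) X) (f : X → 𝕊²), IsSimplifiedBrokenLefschetzFibration o f ∅ 0 → f '' ({p : X | ¬ Surjective (mfderiv (𝓡 4) (𝓡 2) f p)} \ (↑(∅ : Finset X) : Set X)) = sphereEquator 1 → ∀ (v : 𝕊²), (v : 𝔼 3) 0 = 0 → (v : 𝔼 3) 1 = 0 → (∀ y : 𝕊², ⟪(y : 𝔼 3), (v : 𝔼 3)⟫ < 0 → (∀ q, f q = y → Surjective (mfderiv (𝓡 4) (𝓡 2) f q)) ∧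 Nonempty ((Fin (2 * 0) → ℤ) ≃ₗ[ℤ] singularHomology ℤ ℤ ↥(f ⁻¹' {y}) 1)) → (∀ y : 𝕊², ⟪(y : 𝔼 3), ((-v : 𝕊²) : 𝔼 3)⟫ < 0 → (∀ q, f q = y → Surjective (mfderiv (𝓡 4) (𝓡 2) f q)) ∧ Nonempty ((Fin (2 * (0 + 1)) → ℤ) ≃ₗ[ℤ] singularHomology ℤ ℤ ↥(f ⁻¹' {y}) 1)) → ∃ (ε : ℝ) (ν : (Metric.sphere (0 : 𝔼 2) 1) × 𝔼 3 → X), 0 < ε ∧ ε < 1 ∧ ContMDiffOn ((𝓡 1).prod 𝓘(ℝ, 𝔼 3)) (𝓡 4) ∞ ν (Set.univ ×ˢ Metric.ball 0 ε) ∧ Set.InjOn ν (Set.univ ×ˢ Metric.ball 0 ε) ∧ IsOpen (ν '' (Set.univ ×ˢ Metric.ball 0 ε)) ∧ (∀ p : (Metric.sphere (0 : 𝔼 2) 1) × 𝔼 3, p.2 ∈ Metric.ball (0 : 𝔼 3) ε → Function.Injective (mfderiv ((𝓡 1).prod 𝓘(ℝ, 𝔼 3)) (𝓡 4) ν p)) ∧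 (∀ q : X, ¬ Surjective (mfderiv (𝓡 4) (𝓡 2) f q) ↔ ∃ u, ν (u, 0) = q) ∧ (∀ (u : Metric.sphere (0 : 𝔼 2) 1) (x : 𝔼 3), x ∈ Metric.ball (0 : 𝔼 3) ε → ((f (ν (u, x)) : 𝕊²) : 𝔼 3) 0 = √(1 - (x 0 ^ 2 + x 1 ^ 2 - x 2 ^ 2) ^ 2) * (u : 𝔼 2) 0 ∧ ((f (ν (u, x)) : 𝕊²) : 𝔼 3) 1 = √(1 - (x 0 ^ 2 + x 1 ^ 2 - x 2 ^ 2) ^ 2) * (u : 𝔼 2) 1 ∧ ((f (ν (u, x)) : 𝕊²) : 𝔼 3) 2 = (v : 𝔼 3) 2 * (x 0 ^ 2 + x 1 ^ 2 - x 2 ^ 2))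

/-- Statement Ang (to be registered as `helper_sliceGluing_torusAngular`, brick F2'). -/
def StatementAng : Prop :=
  gramain_loopHomotopy_translationLoop_torus → ∀ (X : Type) [TopologicalSpace X] [T2Space X] [SecondCountableTopology X] [CompactSpace X] [ChartedSpace (𝔼 4) X] [IsManifold (𝓡 4) ∞ X] [SimplyConnectedSpace X] (o : SmoothOrientation (𝓡 4) X) (f : X → 𝕊²), IsSimplifiedBrokenLefschetzFibration o f ∅ 0 → f '' ({p : X | ¬ Surjective (mfderiv (𝓡 4) (𝓡 2) f p)} \ (↑(∅ : Finset X) : Set X)) = sphereEquator 1 → ∀ (v : 𝕊²), (v : 𝔼 3) 0 = 0 → (v : 𝔼 3) 1 = 0 → (∀ y : 𝕊², ⟪(y : 𝔼 3), (v : 𝔼 3)⟫ < 0 → (∀ q, f q = y → Surjective (mfderiv (𝓡 4) (𝓡 2) f q)) ∧ Nonempty ((Fin (2 * 0) → ℤ) ≃ₗ[ℤ] singularHomology ℤ ℤ ↥(f ⁻¹' {y}) 1)) → (∀ y : 𝕊², ⟪(y : 𝔼 3), ((-v : 𝕊²) : 𝔼 3)⟫ < 0 → (∀ q, f q = y → Surjective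 (mfderiv (𝓡 4) (𝓡 2) f q)) ∧ Nonempty ((Fin (2 * (0 + 1)) → ℤ) ≃ₗ[ℤ] singularHomology ℤ ℤ ↥(f ⁻¹' {y}) 1)) → ∀ (ε : ℝ) (ν : (Metric.sphere (0 : 𝔼 2) 1) × 𝔼 3 → X), 0 < ε → ε < 1 → ContMDiffOn ((𝓡 1).prod 𝓘(ℝ, 𝔼 3)) (𝓡 4) ∞ ν (Set.univ ×ˢ Metric.ball 0 ε) → Set.InjOn ν (Set.univ ×ˢ Metric.ball 0 ε) → IsOpen (ν '' (Set.univ ×ˢ Metric.ball 0 ε)) → (∀ p : (Metric.sphere (0 : 𝔼 2) 1) × 𝔼 3, p.2 ∈ Metric.ball (0 : 𝔼 3) ε → Function.Injective (mfderiv ((𝓡 1).prod 𝓘(ℝ, 𝔼 3)) (𝓡 4) ν p)) → (∀ q : X, ¬ Surjective (mfderiv (𝓡 4) (𝓡 2) f q) ↔ ∃ u, ν (u, 0) = q) → (∀ (u : Metric.sphere (0 : 𝔼 2) 1) (x : 𝔼 3), x ∈ Metric.ball (0 : 𝔼 3) ε → ((f (ν (u, x)) : 𝕊²) : 𝔼 3)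 0 = √(1 - (x 0 ^ 2 + x 1 ^ 2 - x 2 ^ 2) ^ 2) * (u : 𝔼 2) 0 ∧ ((f (ν (u, x)) : 𝕊²) : 𝔼 3) 1 = √(1 - (x 0 ^ 2 + x 1 ^ 2 - x 2 ^ 2) ^ 2) * (u : 𝔼 2) 1 ∧ ((f (ν (u, x)) : 𝕊²) : 𝔼 3) 2 = (v : 𝔼 3) 2 * (x 0 ^ 2 + x 1 ^ 2 - x 2 ^ 2)) → ∃ (σ sA sB ε₂ : ℝ) (A : X → (Metric.sphere (0 : 𝔼 2) 1)), (σ = 1 ∨ σ = -1) ∧ 0 < sA ∧ sA < sB ∧ 0 < ε₂ ∧ ε₂ ≤ ε ∧ sB < ε₂ ^ 2 / 4 ∧ ContMDiffOn (𝓡 4) (𝓡 1) ∞ A {x | sA < (v : 𝔼 3) 2 * ((f x : 𝕊²) : 𝔼 3) 2} ∧ (∀ x : X, sA < (v : 𝔼 3) 2 * ((f x : 𝕊²) : 𝔼 3) 2 → ∃ y : 𝔼 4, mfderiv (𝓡 4) (𝓡 2) f x y = 0 ∧ mfderiv (𝓡 4) (𝓡 1) A x y ≠ 0) ∧ (∀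 (u : Metric.sphere (0 : 𝔼 2) 1) (x : 𝔼 3), x ∈ Metric.ball (0 : 𝔼 3) ε₂ → sA < x 0 ^ 2 + x 1 ^ 2 - x 2 ^ 2 → x 0 ^ 2 + x 1 ^ 2 - x 2 ^ 2 < sB → ((A (ν (u, x)) : Metric.sphere (0 : 𝔼 2) 1) : 𝔼 2) 0 = Real.cos (Real.arctan (x 2)) * (u : 𝔼 2) 0 + σ * Real.sin (Real.arctan (x 2)) * (u : 𝔼 2) 1 ∧ ((A (ν (u, x)) : Metric.sphere (0 : 𝔼 2) 1) : 𝔼 2) 1 = -Real.sin (Real.arctan (x 2)) * (u : 𝔼 2) 0 + σ * Real.cos (Real.arctan (x 2)) * (u : 𝔼 2) 1) ∧ (∀ (u : Metric.sphere (0 : 𝔼 2) 1) (x : 𝔼 3) (z : X), x ∈ Metric.ball (0 : 𝔼 3) ε₂ → sA < x 0 ^ 2 + x 1 ^ 2 - x 2 ^ 2 → x 0 ^ 2 + x 1 ^ 2 - x 2 ^ 2 < sB → f z = f (ν (u, x)) → A z = A (ν (u, x)) → z ∈ ν '' ({u} ×ˢ Metric.ball (0 : 𝔼 3) ε₂))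

/-- Statement F3 (to be registered as `helper_sliceGluing_bottConstruction`). -/
def StatementF3 : Prop :=
  ∀ (X : Type) [TopologicalSpace X] [T2Space X] [SecondCountableTopology X] [CompactSpace X] [ChartedSpace (𝔼 4) X] [IsManifold (𝓡 4) ∞ X] (o : SmoothOrientation (𝓡 4) X) (f : X → 𝕊²), IsSimplifiedBrokenLefschetzFibration o f ∅ 0 → ∀ (v : 𝕊²) (ιX : 𝕊² × 𝔼 2 → X), (v : 𝔼 3) 0 = 0 → (v : 𝔼 3) 1 = 0 → Manifold.IsSmoothEmbedding ((𝓡 2).prod (𝓡 2)) (𝓡 4) ∞ ιX → range ιX = f ⁻¹' {y : 𝕊² | ⟪(y : 𝔼 3), (v : 𝔼 3)⟫ < 0} → (∀ p, f (ιX p) = (stereographic' 2 v).symm (OpenPartialHomeomorph.univBall (0 : 𝔼 2) 2 p.2)) → ∀ (ε : ℝ) (ν : (Metric.sphere (0 : 𝔼 2) 1) × 𝔼 3 → X), 0 < ε → ε < 1 → ContMDiffOn ((𝓡 1).prod 𝓘(ℝ, 𝔼 3)) (𝓡 4) ∞ ν (Set.univ ×ˢ Metric.ball 0 ε) → Set.InjOn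 ν (Set.univ ×ˢ Metric.ball 0 ε) → IsOpen (ν '' (Set.univ ×ˢ Metric.ball 0 ε)) → (∀ p : (Metric.sphere (0 : 𝔼 2) 1) × 𝔼 3, p.2 ∈ Metric.ball (0 : 𝔼 3) ε → Function.Injective (mfderiv ((𝓡 1).prod 𝓘(ℝ, 𝔼 3)) (𝓡 4) ν p)) → (∀ q : X, ¬ Surjective (mfderiv (𝓡 4) (𝓡 2) f q) ↔ ∃ u, ν (u, 0) = q) → (∀ (u : Metric.sphere (0 : 𝔼 2) 1) (x : 𝔼 3), x ∈ Metric.ball (0 : 𝔼 3) ε → ((f (ν (u, x)) : 𝕊²) : 𝔼 3) 0 = √(1 - (x 0 ^ 2 + x 1 ^ 2 - x 2 ^ 2) ^ 2) * (u : 𝔼 2) 0 ∧ ((f (ν (u, x)) : 𝕊²) : 𝔼 3) 1 = √(1 - (x 0 ^ 2 + x 1 ^ 2 - x 2 ^ 2) ^ 2) * (u : 𝔼 2) 1 ∧ ((f (ν (u, x)) : 𝕊²) : 𝔼 3) 2 = (v : 𝔼 3) 2 * (x 0 ^ 2 + x 1 ^ 2 - x 2 ^ 2)) → ∀ (σ sA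 sB ε₂ : ℝ) (A : X → (Metric.sphere (0 : 𝔼 2) 1)), (σ = 1 ∨ σ = -1) → 0 < sA → sA < sB → 0 < ε₂ → ε₂ ≤ ε → sB < ε₂ ^ 2 / 4 → ContMDiffOn (𝓡 4) (𝓡 1) ∞ A {x | sA < (v : 𝔼 3) 2 * ((f x : 𝕊²) : 𝔼 3) 2} → (∀ x : X, sA < (v : 𝔼 3) 2 * ((f x : 𝕊²) : 𝔼 3) 2 → ∃ y : 𝔼 4, mfderiv (𝓡 4) (𝓡 2) f x y = 0 ∧ mfderiv (𝓡 4) (𝓡 1) A x y ≠ 0) → (∀ (u : Metric.sphere (0 : 𝔼 2) 1) (x : 𝔼 3), x ∈ Metric.ball (0 : 𝔼 3) ε₂ → sA < x 0 ^ 2 + x 1 ^ 2 - x 2 ^ 2 → x 0 ^ 2 + x 1 ^ 2 - x 2 ^ 2 < sB → ((A (ν (u, x)) : Metric.sphere (0 : 𝔼 2) 1) : 𝔼 2) 0 = Real.cos (Real.arctan (x 2)) * (u : 𝔼 2) 0 + σ * Real.sin (Real.arctan (x 2)) * (u : 𝔼 2) 1 ∧ ((A (ν (u, x)) : Metric.sphere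 (0 : 𝔼 2) 1) : 𝔼 2) 1 = -Real.sin (Real.arctan (x 2)) * (u : 𝔼 2) 0 + σ * Real.cos (Real.arctan (x 2)) * (u : 𝔼 2) 1) → (∀ (u : Metric.sphere (0 : 𝔼 2) 1) (x : 𝔼 3) (z : X), x ∈ Metric.ball (0 : 𝔼 3) ε₂ → sA < x 0 ^ 2 + x 1 ^ 2 - x 2 ^ 2 → x 0 ^ 2 + x 1 ^ 2 - x 2 ^ 2 < sB → f z = f (ν (u, x)) → A z = A (ν (u, x)) → z ∈ ν '' ({u} ×ˢ Metric.ball (0 : 𝔼 3) ε₂)) → ∃ (F : X → ℝ) (a' a b : ℝ) (_ : IsRegularLevel (𝓡 4) F a) (e : (Metric.sphere (0 : 𝔼 2) 1) → X) (α : X → 𝔼 2), a' < a ∧ a < b ∧ Manifold.IsSmoothEmbedding (𝓡 1) (𝓡 4) ∞ e ∧ (∀ x, a ≤ F x → F x ≤ b) ∧ (∀ x, a ≤ F x → (IsMCriticalPt (𝓡 4) F x ↔ x ∈ range e)) ∧ (∀ u, F (e u) = b) ∧ (∀ (u : Metric.sphere (0 : 𝔼 2) 1) (w : 𝔼 4),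 mhessian (𝓡 4) F (e u) w w ≤ 0 ∧ (mhessian (𝓡 4) F (e u) w w = 0 → w ∈ range (mfderiv (𝓡 1) (𝓡 4) e u))) ∧ ContMDiffOn (𝓡 4) 𝓘(ℝ, 𝔼 2) ∞ α {x | a' < F x} ∧ (∀ x, a' < F x → ‖α x‖ = 1) ∧ (∀ u : Metric.sphere (0 : 𝔼 2) 1, α (e u) = (u : 𝔼 2)) ∧ (∀ x, a ≤ F x → x ∉ range e → ∀ (r : ℝ) (w : 𝔼 2), ⟪w, α x⟫ = 0 → ∃ y : 𝔼 4, mfderiv (𝓡 4) 𝓘(ℝ, ℝ) F x y = r ∧ mfderiv (𝓡 4) 𝓘(ℝ, 𝔼 2) α x y = w) ∧ ((fun y => (-1 / 2 : ℝ) - (SphereHeight.height (v : 𝔼 3) ∘ f) y) ⁻¹' Set.Iic 0 = (fun y => a - F y) ⁻¹' Set.Iic 0) ∧ (∀ x, (SphereHeight.height (v : 𝔼 3) ∘ f) x = -1 / 2 → F x = a) ∧ (∀ p : 𝕊² × 𝔼 2, (SphereHeight.height (v : 𝔼 3) ∘ f) (ιX p) = -1 / 2 → α (ιX p) = (√2 :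 ℝ) • p.2 ∧ ‖p.2‖ ^ 2 = 1 / 2)

/-- Statement F (registered `helper_sliceGluing_bottFunction`). -/
def StatementF' : Prop :=
  gramain_loopHomotopy_translationLoop_torus → ∀ (X : Type) [TopologicalSpace X] [T2Space X] [SecondCountableTopology X] [CompactSpace X] [ChartedSpace (𝔼 4) X] [IsManifold (𝓡 4) ∞ X] [SimplyConnectedSpace X] (o : SmoothOrientation (𝓡 4) X) (f : X → 𝕊²), IsSimplifiedBrokenLefschetzFibration o f ∅ 0 → f '' ({p : X | ¬ Surjective (mfderiv (𝓡 4) (𝓡 2) f p)} \ (↑(∅ : Finset X) : Set X)) = sphereEquator 1 → ∀ (v : 𝕊²) (ιX : 𝕊² × 𝔼 2 → X), (v : 𝔼 3) 0 = 0 → (v : 𝔼 3) 1 = 0 → Manifold.IsSmoothEmbedding ((𝓡 2).prod (𝓡 2)) (𝓡 4) ∞ ιX → range ιX = f ⁻¹' {y : 𝕊² | ⟪(y : 𝔼 3), (v : 𝔼 3)⟫ < 0} → (∀ p, f (ιX p) = (stereographic' 2 v).symm (OpenPartialHomeomorph.univBall (0 : 𝔼 2) 2 p.2)) → (∀ y :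 𝕊², ⟪(y : 𝔼 3), ((-v : 𝕊²) : 𝔼 3)⟫ < 0 → (∀ q, f q = y → Surjective (mfderiv (𝓡 4) (𝓡 2) f q)) ∧ Module.finrank ℤ (singularHomology ℤ ℤ ↥(f ⁻¹' {y}) 1) = 2) → ∃ (F : X → ℝ) (a' a b : ℝ) (_ : IsRegularLevel (𝓡 4) F a) (e : (Metric.sphere (0 : 𝔼 2) 1) → X) (α : X → 𝔼 2), a' < a ∧ a < b ∧ Manifold.IsSmoothEmbedding (𝓡 1) (𝓡 4) ∞ e ∧ (∀ x, a ≤ F x → F x ≤ b) ∧ (∀ x, a ≤ F x → (IsMCriticalPt (𝓡 4) F x ↔ x ∈ range e)) ∧ (∀ u, F (e u) = b) ∧ (∀ (u : Metric.sphere (0 : 𝔼 2) 1) (w : 𝔼 4), mhessian (𝓡 4) F (e u) w w ≤ 0 ∧ (mhessian (𝓡 4) F (e u) w w = 0 → w ∈ range (mfderiv (𝓡 1) (𝓡 4) e u))) ∧ ContMDiffOn (𝓡 4) 𝓘(ℝ, 𝔼 2) ∞ α {x | a' < F x} ∧ (∀ x, a' < F x → ‖α x‖ = 1) ∧ (∀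 u : Metric.sphere (0 : 𝔼 2) 1, α (e u) = (u : 𝔼 2)) ∧ (∀ x, a ≤ F x → x ∉ range e → ∀ (r : ℝ) (w : 𝔼 2), ⟪w, α x⟫ = 0 → ∃ y : 𝔼 4, mfderiv (𝓡 4) 𝓘(ℝ, ℝ) F x y = r ∧ mfderiv (𝓡 4) 𝓘(ℝ, 𝔼 2) α x y = w) ∧ ((fun y => (-1 / 2 : ℝ) - (SphereHeight.height (v : 𝔼 3) ∘ f) y) ⁻¹' Set.Iic 0 = (fun y => a - F y) ⁻¹' Set.Iic 0) ∧ (∀ x, (SphereHeight.height (v : 𝔼 3) ∘ f) x = -1 / 2 → F x = a) ∧ (∀ p : 𝕊² × 𝔼 2, (SphereHeight.height (v : 𝔼 3) ∘ f) (ιX p) = -1 / 2 → α (ιX p) = (√2 : ℝ) • p.2 ∧ ‖p.2‖ ^ 2 = 1 / 2)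

/-- **Assembly check: brick F follows from N, Ang and F3.**  The only work is to produce the
pole data in the form N and Ang want (`exists_pole_lower_higher_sides`, the pole being forced
to be `v` by the ranks of `H₁` of the two sides). -/
theorem bottFunction_of_bricks (hN : StatementN) (hAng : StatementAng) (hF3 : StatementF3) :
    StatementF' := by
  intro hEE X _ _ _ _ _ _ _ o f hf hC v ιX hv0 hv1 hemb hrange hιf hhi
  -- the pole of `exists_pole_lower_higher_sides` is `v`
  obtain ⟨v', hv0', hv1', hlo', hhi'⟩ := hf.exists_pole_lower_higher_sides hC
  have hvv : v' = v := by
    by_contra hne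
    -- `v' = -v`: both are `(0, 0, ±1)`
    have h3 : ∀ w : 𝕊², (w : 𝔼 3) 0 = 0 → (w : 𝔼 3) 1 = 0 → (w : 𝔼 3) 2 = 1 ∨ (w : 𝔼 3) 2 = -1 := by
      intro w h0 h1
      have hn : ‖(w : 𝔼 3)‖ = 1 := by simp
      have hsq : (w : 𝔼 3) 2 ^ 2 = 1 := by
        have := EuclideanSpace.norm_sq_eq (w : 𝔼 3)
        rw [hn] at this
        simp [Fin.sum_univ_three, h0, h1, sq_abs] at this
        linarith
      have h1' : ((w : 𝔼 3) 2 - 1) * ((w : 𝔼 3) 2 + 1) = 0 := by ring_nf; linarith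
      rcases mul_eq_zero.mp h1' with h | h
      · exact Or.inl (by linarith)
      · exact Or.inr (by linarith)
    have hext : ∀ w w' : 𝕊², (w : 𝔼 3) 0 = (w' : 𝔼 3) 0 → (w : 𝔼 3) 1 = (w' : 𝔼 3) 1 →
        (w : 𝔼 3) 2 = (w' : 𝔼 3) 2 → w = w' := by
      intro w w' e0 e1 e2
      apply Subtype.ext
      ext i
      fin_cases i
      · exact e0
      · exact e1
      · exact e2
    have hneg : v' = -v := by
      rcases h3 v' hv0' hv1' with h | h <;> rcases h3 v hv0 hv1 with h' | h'
      · exact absurd (hext v' v (by rw [hv0', hv0]) (by rw [hv1', hv1]) (by rw [h, h'])) hne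
      · apply hext <;> simp [hv0', hv0, hv1', hv1, h, h']
      · apply hext <;> simp [hv0', hv0, hv1', hv1, h, h']
      · exact absurd (hext v' v (by rw [hv0', hv0]) (by rw [hv1', hv1]) (by rw [h, h'])) hne
    -- over `y = v`: `H₁ = 0` by `hlo'` (as `⟪v, v'⟫ = -1 < 0`) but rank `2` by `hhi`
    have hin : ⟪((v : 𝕊²) : 𝔼 3), ((v' : 𝕊²) : 𝔼 3)⟫ < 0 := by
      rw [hneg]
      simp
    have hin2 : ⟪((v : 𝕊²) : 𝔼 3), ((-v : 𝕊²) : 𝔼 3)⟫ < 0 := by simp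
    obtain ⟨-, ⟨e0⟩⟩ := hlo' v hin
    obtain ⟨-, h2⟩ := hhi v hin2
    have : Module.finrank ℤ (singularHomology ℤ ℤ ↥(f ⁻¹' {v}) 1) = 0 := by
      rw [← e0.finrank_eq]; simp
    omega
  subst hvv
  obtain ⟨ε, ν, hε, hε1, hνs, hνi, hνo, hνd, hνz, hνf⟩ := hN X o f hf hC v' hv0 hv1 hlo' hhi'
  obtain ⟨σ, sA, sB, ε₂, A, hσ, hsA, hAB, hε₂, hε₂ε, hsB, hAs, hAsub, hAm, hAlev⟩ :=
    hAng hEE X o f hf hC v' hv0 hv1 hlo' hhi' ε ν hε hε1 hνs hνi hνo hνd hνz hνf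
  exact hF3 X o f hf v' ιX hv0 hv1 hemb hrange hιf ε ν hε hε1 hνs hνi hνo hνd hνz hνf σ sA sB ε₂ A
    hσ hsA hAB hε₂ hε₂ε hsB hAs hAsub hAm hAlev

end Summit.SmoothPoincare4.SmoothPoincare4.Cruxes.RungOne.Sketch
end
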